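import Literature.NumberTheory.IwasawaTheory.FukudaRankCountingLemmas
import Literature.NumberTheory.NumberFields.ArtinMapDecompositionInertia
import Literature.NumberTheory.GaloisRepresentations.GlobalArtinMapOfCharactersProofs
import Literature.NumberTheory.GaloisRepresentations.ArtinRestriction
import Literature.NumberTheory.GaloisRepresentations.FrobeniusDensityTheorem
import HarnessLib

/-!
# Everywhere-unramified homomorphisms on an open normal subgroup of `Γ_K` with values in a `p^k`-torsion group:
# the SHARP class-field-theoretic count `#T ≤ #M ^ rank` (proved; `p` odd or `K` totally complex)

`Proofs`-style file (theorems only: no definition, no named fact, no `sorry`) in topic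
`NumberTheory/NumberFields`, namespace `Literature.NumberTheory.NumberFields.UnramifiedHomsClassGroupPRankBoundSharp`,
written by the prover seat `bsd-potss-rkm` g34 (cell `bsd-potss`, item stmt-BirchSwinnertonDyer-19196; closes nothing).
It is the sharpening of the sibling `UnramifiedHomsClassGroupPRankBound.card_le_pow_index_of_unramified`
(seat `bsd-potss-k8t-c4` g21, whose §0–§3 are reproduced verbatim up to the exponent) needed for the discharge of the
named fact `IwasawaTheory.classicalMuVanishes_finite_unramifiedClasses` (Iwasawa's `μ = 0` in character form):

* the target group `M` may be killed by a prime POWER `q = p^k` (the sibling: `p·M = 0`);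
* `p = 2` is allowed when `K` is totally complex (then every finite extension of `K` is totally complex and every
  extension of number fields above `K` is unramified at the infinite places);
* the count is by HOMOMORPHISMS, not by functions: **`#T ≤ #M ^ r`** where `p^r = [G : N₂]` divides
  `[Cl(F) : Cl(F)^q]` (so `r ≤ ord_p [Cl(F) : Cl(F)^q] ≤ ord_p #Cl(F)`), instead of the sibling's `#T ≤ #M ^ [Cl(F) : Cl(F)^p]`.
  The gain is exponential and is exactly what the growth-form argument for `μ = 0` consumes.

**Theorem** (`card_le_pow_padicValNat_index_of_unramified`). Let `K` be a number field, `p` a prime with `p` odd or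
`K` totally complex, `q = p^k`, `U ≤ Γ_K` an open normal subgroup with fixed field `F = K̄^U`, `W ≤ U` an open subgroup
normal in `Γ_K`, and `M` a finite abelian group killed by `q`. Every finite set `T` of additive maps `g : U → M` that
kill `W` and kill `U ∩ I_𝔓` for EVERY maximal ideal `𝔓` of `\bar ℤ_K` has
`#T ≤ #M ^ ord_p [Cl(F) : Cl(F)^q]`, hence (`card_le_pow_padicValNat_card_classGroup_of_unramified`)
`#T ≤ #M ^ ord_p #Cl(F)`.

Proof: §1 `U' = W · [U,U] · U^q ≤ U` is killed by every `g`; §2 `E' = K̄^{U'}` is finite Galois over `F`, with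
`G = Gal(E'/F)` of exponent `q` — a `p`-group, of odd order when `p` is odd, so that `E'/F` is unramified at the
infinite places (Mathlib `IsUnramifiedAtInfinitePlaces_of_odd_card_aut`); when `K` is totally complex so is `F`
(Mathlib `isTotallyComplex_of_algebra`) and every infinite place of `E'` is unramified over `F`
(`InfinitePlace.isUnramified_iff`); §3 the inertia groups of `G` are restrictions of absolute inertia groups (tree
`inertia_comap_ringOfIntegers_eq_map_absRestrictNormalHom`), so every descended `ḡ : G → M` kills them; §4 by the
tree's `index_sup_pow_dvd_index_range_pow` (Washington 13.15 / 13.23, ANY exponent) the subgroup `N₂` generated by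
commutators, inertia groups and `q`-th powers has `[G : N₂] ∣ [Cl(F) : Cl(F)^q]`; the `p`-group `G/N₂`, of order `p^r`,
is generated by `r` elements (`exists_finset_card_le_closure_eq_top_of_isPGroup`: a proper subgroup of a `p`-group has
index `≥ p`), and the `ḡ` are HOMOMORPHISMS `G/N₂ → M`, determined by their values on the generators: `#T ≤ #M ^ r`.

References: [Washington1997] §13.3 (Lemma 13.15, Prop. 13.22/13.23: `rank_p A` via the maximal unramified abelian
extension of exponent `p`); [Cox2013] §5.C Cor. 5.24; [SerreLocalFields1979] Ch. I §7 Prop. 22 (b);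
[CoatesSujatha2005] Thm. 3.4 (proof); [KuriharaPollack2007] §3.1; [Lang1990] Ch. 5 §4 (`C_n ≈ Gal(M_n/K_n)`).
-/

set_option autoImplicit false

noncomputable section

open scoped Classical Pointwise NumberField
open NumberField IsDedekindDomain Field IntermediateField

namespace Literature.NumberTheory.NumberFields.UnramifiedHomsClassGroupPRankBoundSharp

open Literature.NumberTheory.EllipticCurves Literature.NumberTheory.GaloisRepresentations
  Literature.NumberTheory.NumberFields

variable {K : Type} [Field K] [NumberField K]

/-! ## §0 Small group-theoretic and arithmetic helpers -/

/-- A subgroup containing the commutator subgroup is normal. [folklore] -/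
private theorem normal_of_commutator_le {G : Type*} [Group G] {N : Subgroup G} (h : ⁅(⊤ : Subgroup G), ⊤⁆ ≤ N) :
    N.Normal :=
  ⟨fun m hm g => by
    have h2 := Subgroup.commutator_mem_commutator (Subgroup.mem_top g) (Subgroup.mem_top m)
    rw [commutatorElement_def] at h2
    have h1 : g * m * g⁻¹ = g * m * g⁻¹ * m⁻¹ * m := by group
    rw [h1]
    exact mul_mem (h h2) hm⟩

/-- `[Cl : Cl^p]` is invariant under isomorphism of class groups. [folklore] -/
private theorem index_range_pow_eq_of_mulEquiv {G H : Type*} [CommGroup G] [CommGroup H] (e : G ≃* H) (p : ℕ) :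
    (powMonoidHom p : H →* H).range.index = (powMonoidHom p : G →* G).range.index := by
  have hmap : (powMonoidHom p : G →* G).range.map e.toMonoidHom = (powMonoidHom p : H →* H).range := by
    ext h
    constructor
    · rintro ⟨x, ⟨y, rfl⟩, rfl⟩
      exact ⟨e y, by rw [powMonoidHom_apply, powMonoidHom_apply, MulEquiv.coe_toMonoidHom, map_pow]⟩
    · rintro ⟨y, rfl⟩
      refine ⟨e.symm y ^ p, ⟨e.symm y, rfl⟩, ?_⟩
      rw [powMonoidHom_apply, MulEquiv.coe_toMonoidHom, map_pow, MulEquiv.apply_symm_apply]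
  rw [← hmap, Subgroup.index_map_of_bijective e.bijective]

/-- An additive map `g` from a group to an abelian group killed by `p` has a kernel SUBGROUP containing the
commutators and the `p`-th powers. [folklore] -/
private theorem exists_ker_subgroup {G : Type*} [Group G] {M : Type*} [AddCommGroup M]
    (p : ℕ) (hpM : ∀ m : M, p • m = 0) (g : G → M) (hadd : ∀ u v, g (u * v) = g u + g v) :
    ∃ Z : Subgroup G, (∀ x, x ∈ Z ↔ g x = 0) ∧ ⁅(⊤ : Subgroup G), ⊤⁆ ≤ Z ∧
      Subgroup.closure (Set.range fun u : G => u ^ p) ≤ Z := by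
  let ĝ : G →* Multiplicative M :=
    { toFun := fun u => Multiplicative.ofAdd (g u)
      map_one' := by
        have h := hadd 1 1
        rw [mul_one, left_eq_add] at h
        rw [h]; rfl
      map_mul' := fun a b => by rw [hadd, ofAdd_add] }
  refine ⟨ĝ.ker, fun x => ?_, ?_, ?_⟩
  · rw [MonoidHom.mem_ker]
    exact ⟨fun h => Multiplicative.ofAdd.injective h, fun h => by
      change Multiplicative.ofAdd (g x) = 1
      rw [h]; rfl⟩
  · intro y hy
    rw [← commutator_def] at hy
    exact Abelianization.commutator_subset_ker ĝ hy
  · rw [Subgroup.closure_le]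
    rintro _ ⟨y, rfl⟩
    rw [SetLike.mem_coe, MonoidHom.mem_ker, map_pow]
    change Multiplicative.ofAdd (g y) ^ p = 1
    rw [← ofAdd_nsmul, hpM]; rfl

omit [NumberField K] in
/-- A prime of `\bar ℤ_K` above a given maximal ideal of `𝓞 L`, for a number field `L ⊆ K̄`
(integrality of `\bar ℤ_K` over `𝓞 L`); it is maximal. [folklore] -/
private theorem exists_isMaximal_comap_ringOfIntegersToIntegralClosure_eq
    (L : IntermediateField K (AlgebraicClosure K)) (Q : Ideal (𝓞 L)) [hQ : Q.IsMaximal] :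
    ∃ 𝔓 : Ideal (absIntegers (𝓞 K) K), 𝔓.IsMaximal ∧
      𝔓.comap (EllipticCurves.ringOfIntegersToIntegralClosure (k := K)
        (Ω := AlgebraicClosure K) L) = Q := by
  set φ : 𝓞 L →+* absIntegers (𝓞 K) K :=
    EllipticCurves.ringOfIntegersToIntegralClosure (k := K) (Ω := AlgebraicClosure K) L with hφ
  letI : Algebra (𝓞 L) (absIntegers (𝓞 K) K) := φ.toAlgebra
  haveI : IsScalarTower (𝓞 K) (𝓞 L) (absIntegers (𝓞 K) K) :=
    IsScalarTower.of_algebraMap_eq fun x ↦ rfl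
  haveI : Algebra.IsIntegral (𝓞 L) (absIntegers (𝓞 K) K) :=
    ⟨fun x ↦ (Algebra.IsIntegral.isIntegral (R := 𝓞 K) x).tower_top⟩
  obtain ⟨𝔓, -, h𝔓prime, h𝔓Q⟩ := Ideal.exists_ideal_over_prime_of_isIntegral Q
    (⊥ : Ideal (absIntegers (𝓞 K) K))
    (fun x hx ↦ by
      rw [Ideal.mem_comap, Ideal.mem_bot] at hx
      have hx0 : x = 0 :=
        EllipticCurves.ringOfIntegersToIntegralClosure_injective L (hx.trans (map_zero _).symm)
      rw [hx0]
      exact Q.zero_mem)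
  haveI := h𝔓prime
  refine ⟨𝔓, Ideal.isMaximal_of_isIntegral_of_isMaximal_comap (R := 𝓞 L) 𝔓 ?_, h𝔓Q⟩
  rw [h𝔓Q]
  exact hQ

/-! ## §1 The subgroup `U' = W · [U,U] · U^p` -/

section Main

variable (p : ℕ) [Fact p.Prime]
  (U : Subgroup (absoluteGaloisGroup K)) [hUn : U.Normal]
  (W : Subgroup (absoluteGaloisGroup K)) [hWn : W.Normal]

omit [NumberField K] [Fact p.Prime] in
/-- The subgroup of `U` generated (inside `U`) by `W ∩ U`, the commutators and the `p`-th powers, pushed to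
`Γ_K`, is normal in `Γ_K`: each generating piece is stable under conjugation by `Γ_K`, which acts on the
normal subgroup `U` through `MulAut.conjNormal`. [folklore] -/
private theorem map_subtype_sup_normal :
    ((W.subgroupOf U ⊔ ⁅(⊤ : Subgroup U), ⊤⁆ ⊔
      Subgroup.closure (Set.range fun u : U => u ^ p)).map U.subtype).Normal := by
  set S : Subgroup U := W.subgroupOf U ⊔ ⁅(⊤ : Subgroup U), ⊤⁆ ⊔
    Subgroup.closure (Set.range fun u : U => u ^ p) with hS
  -- `S` is stable under `conjNormal γ` for every `γ`
  have hstab : ∀ γ : absoluteGaloisGroup K, S.map (MulAut.conjNormal γ : U ≃* U).toMonoidHom ≤ S := by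
    intro γ
    rw [hS, Subgroup.map_sup, Subgroup.map_sup]
    refine sup_le (sup_le ?_ ?_) ?_
    · -- `W ∩ U`
      rintro _ ⟨x, hx, rfl⟩
      have hxW : (x : absoluteGaloisGroup K) ∈ W := Subgroup.mem_subgroupOf.1 hx
      refine Subgroup.mem_sup_left (Subgroup.mem_sup_left (Subgroup.mem_subgroupOf.2 ?_))
      change (((MulAut.conjNormal γ : U ≃* U) x : U) : absoluteGaloisGroup K) ∈ W
      rw [MulAut.conjNormal_apply]
      exact hWn.conj_mem _ hxW γ
    · -- commutators
      rw [Subgroup.map_commutator]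
      exact (Subgroup.commutator_mono le_top le_top).trans (le_sup_right.trans le_sup_left)
    · -- `p`-th powers
      rw [MonoidHom.map_closure]
      refine (Subgroup.closure_mono ?_).trans le_sup_right
      rintro _ ⟨_, ⟨u, rfl⟩, rfl⟩
      exact ⟨(MulAut.conjNormal γ : U ≃* U) u, (map_pow _ u p).symm⟩
  refine ⟨fun n hn γ => ?_⟩
  obtain ⟨x, hx, rfl⟩ := hn
  have hmem : (MulAut.conjNormal γ : U ≃* U) x ∈ S := hstab γ ⟨x, hx, rfl⟩
  refine ⟨(MulAut.conjNormal γ : U ≃* U) x, hmem, ?_⟩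
  rw [Subgroup.coe_subtype, MulAut.conjNormal_apply]

/-! ## §2 Generators of a finite `p`-group -/

omit [NumberField K] in
/-- **A `p`-group of order `p^r` is generated by at most `r` elements**, in the form used below: there is a
finite generating set `s` with `p ^ #s ≤ #G` (greedy: as long as `⟨s⟩ ≠ G`, adjoining an element outside `⟨s⟩`
multiplies the order of the generated subgroup by its index in the new one, a positive power of `p`).
[cite: SerreLocalFields1979, Ch. IX §1 (p-groups)] [folklore] -/
theorem exists_finset_card_le_closure_eq_top_of_isPGroup {G : Type*} [Group G] [Finite G]
    (hG : IsPGroup p G) :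
    ∃ s : Finset G, Subgroup.closure (s : Set G) = ⊤ ∧ p ^ s.card ≤ Nat.card G := by
  classical
  have hpr : p.Prime := Fact.out
  -- greedy induction: `#s ≤ j` and (`⟨s⟩ = G` or `p^j ≤ #⟨s⟩`)
  have key : ∀ j : ℕ, ∃ s : Finset G, s.card ≤ j ∧
      (Subgroup.closure (s : Set G) = ⊤ ∨ p ^ j ≤ Nat.card (Subgroup.closure (s : Set G))) := by
    intro j
    induction j with
    | zero =>
      refine ⟨∅, le_rfl, Or.inr ?_⟩
      rw [pow_zero]
      exact Nat.card_pos
    | succ j ih =>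
      obtain ⟨s, hs, hcl⟩ := ih
      by_cases htop : Subgroup.closure (s : Set G) = ⊤
      · exact ⟨s, hs.trans (Nat.le_succ j), Or.inl htop⟩
      have hpj : p ^ j ≤ Nat.card (Subgroup.closure (s : Set G)) := hcl.resolve_left htop
      -- an element outside `⟨s⟩`
      obtain ⟨x, hx⟩ : ∃ x : G, x ∉ Subgroup.closure (s : Set G) := by
        by_contra h
        exact htop (eq_top_iff.2 fun x _ => by
          by_contra hx
          exact h ⟨x, hx⟩)
      set H := Subgroup.closure (s : Set G) with hH
      set H' := Subgroup.closure ((insert x s : Finset G) : Set G) with hH'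
      have hle : H ≤ H' := Subgroup.closure_mono (by
        rw [Finset.coe_insert]; exact Set.subset_insert _ _)
      have hxH' : x ∈ H' := Subgroup.subset_closure (by
        rw [Finset.coe_insert]; exact Set.mem_insert _ _)
      -- the index of `H` in `H'` is a positive power of `p`
      have hH'p : IsPGroup p H' := hG.to_subgroup H'
      obtain ⟨n, hn⟩ := hH'p.index (H.subgroupOf H')
      have hn0 : n ≠ 0 := by
        rintro rfl
        rw [pow_zero, Subgroup.index_eq_one, Subgroup.subgroupOf_eq_top] at hn
        exact hx (hn hxH')
      have hcard : Nat.card (H.subgroupOf H') * (H.subgroupOf H').index = Nat.card H' :=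
        Subgroup.card_mul_index _
      have hcardH : Nat.card (H.subgroupOf H') = Nat.card H :=
        Nat.card_congr (Subgroup.subgroupOfEquivOfLe hle).toEquiv
      refine ⟨insert x s, (Finset.card_insert_le x s).trans (Nat.succ_le_succ hs), Or.inr ?_⟩
      calc p ^ (j + 1) = p ^ j * p := pow_succ p j
        _ ≤ Nat.card H * p ^ n := by
            refine Nat.mul_le_mul hpj ?_
            calc p = p ^ 1 := (pow_one p).symm
              _ ≤ p ^ n := Nat.pow_le_pow_right hpr.pos (Nat.one_le_iff_ne_zero.2 hn0)
        _ = Nat.card H' := by rw [← hcard, hcardH, hn]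
  obtain ⟨r, hr⟩ := hG.exists_card_eq
  obtain ⟨s, hs, hcl⟩ := key r
  rcases hcl with hcl | hcl
  · refine ⟨s, hcl, ?_⟩
    rw [hr]
    exact Nat.pow_le_pow_right hpr.pos hs
  · -- `p^r ≤ #⟨s⟩ ≤ #G = p^r` forces `⟨s⟩ = G`
    have hfull : Subgroup.closure (s : Set G) = ⊤ := by
      apply Subgroup.eq_top_of_card_eq
      refine le_antisymm (Subgroup.card_le_card_group _) ?_
      rw [hr]; exact hcl
    refine ⟨s, hfull, ?_⟩
    rw [hr]
    exact Nat.pow_le_pow_right hpr.pos hs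

omit [NumberField K] [Fact p.Prime] in
/-- Additive maps out of a group into an abelian group that agree on a generating set agree everywhere
(`MonoidHom.eq_of_eqOn_dense` for the associated homomorphisms to `Multiplicative M`; private helper). [folklore] -/
private theorem eq_of_eqOn_closure_eq_top {G : Type*} [Group G] {M : Type*} [AddCommGroup M]
    {s : Set G} (hs : Subgroup.closure s = ⊤) {f g : G → M}
    (hf : ∀ a b, f (a * b) = f a + f b) (hg : ∀ a b, g (a * b) = g a + g b)
    (h : Set.EqOn f g s) : f = g := by
  have hf1 : f 1 = 0 := by
    have h1 := hf 1 1
    rw [mul_one, left_eq_add] at h1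
    exact h1
  have hg1 : g 1 = 0 := by
    have h1 := hg 1 1
    rw [mul_one, left_eq_add] at h1
    exact h1
  let F : G →* Multiplicative M :=
    { toFun := fun u => Multiplicative.ofAdd (f u)
      map_one' := by rw [hf1]; rfl
      map_mul' := fun a b => by rw [hf, ofAdd_add] }
  let G' : G →* Multiplicative M :=
    { toFun := fun u => Multiplicative.ofAdd (g u)
      map_one' := by rw [hg1]; rfl
      map_mul' := fun a b => by rw [hg, ofAdd_add] }
  have hFG : F = G' := MonoidHom.eq_of_eqOn_dense hs (fun x hx => by
    change Multiplicative.ofAdd (f x) = Multiplicative.ofAdd (g x)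
    rw [h hx])
  funext u
  have := congrArg (fun φ : G →* Multiplicative M => (φ u).toAdd) hFG
  exact this

/-! ## §3–§5 The count -/

/-- **Sharp CFT count.** For `K` a number field, `p` a prime with `p ≠ 2` or `K` totally complex, `q = p^k`,
`U ≤ Γ_K` open normal with fixed field `F = K̄^U`, `W ≤ U` open and normal in `Γ_K`, `M` a finite abelian group
with `q·M = 0`: a finite set `T` of maps `g : U → M` that are additive, kill `W` and kill `U ∩ I_𝔓` for every
maximal ideal `𝔓` of `\bar ℤ_K` (everywhere unramified) has **`#T ≤ #M ^ ord_p [Cl(F) : Cl(F)^q]`**.  All `g`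
factor through HOMOMORPHISMS `G/N₂ → M`, where `G = Gal(E'/F)` for `E' = K̄^{W·[U,U]·U^q}` (an abelian extension of
`F` of exponent `q`, unramified at the infinite places: `p` odd ⟹ `#G` odd; `K` totally complex ⟹ `F` totally
complex) and `N₂` is generated by commutators, inertia groups and `q`-th powers; the tree's
`index_sup_pow_dvd_index_range_pow` (Washington Lemma 13.15 / Prop. 13.23, Cox Cor. 5.24) gives
`[G : N₂] ∣ [Cl(F) : Cl(F)^q]`, and a `p`-group of order `p^r` is generated by `r` elements.
[cite: Washington1997, §13.3 Lemma 13.15 and Prop. 13.23] [cite: Cox2013, §5.C Cor. 5.24]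
[cite: SerreLocalFields1979, Ch. I §7 Prop. 22(b)] [cite: Lang1990, Ch. 5 §4 (pp. 137–143)] -/
theorem card_le_pow_padicValNat_index_of_unramified (hp : p ≠ 2 ∨ NumberField.IsTotallyComplex K) (k : ℕ)
    (hU : IsOpen (U : Set (absoluteGaloisGroup K)))
    (hW : IsOpen (W : Set (absoluteGaloisGroup K))) (hWU : W ≤ U)
    (M : Type) [AddCommGroup M] [Finite M] (hpM : ∀ m : M, p ^ k • m = 0)
    (T : Finset (U → M))
    (hadd : ∀ g ∈ T, ∀ u v : U, g (u * v) = g u + g v)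
    (hW0 : ∀ g ∈ T, ∀ u : U, (u : absoluteGaloisGroup K) ∈ W → g u = 0)
    (hI0 : ∀ g ∈ T, ∀ (𝔓 : Ideal (absIntegers (𝓞 K) K)), 𝔓.IsMaximal →
      ∀ u : U, (u : absoluteGaloisGroup K) ∈ 𝔓.inertia (absoluteGaloisGroup K) → g u = 0) :
    T.card ≤ Nat.card M ^ padicValNat p
      ((powMonoidHom (p ^ k) : ClassGroup (𝓞 (fixedField U : IntermediateField K (AlgebraicClosure K))) →*
        ClassGroup (𝓞 (fixedField U : IntermediateField K (AlgebraicClosure K)))).range.index) := by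
  have hpr : p.Prime := Fact.out
  haveI : Algebra.IsAlgebraic K (AlgebraicClosure K) := AlgebraicClosure.isAlgebraic K
  haveI : IsGalois K (AlgebraicClosure K) := {}
  -- restriction to a normal subfield, applied to an element
  have hres_apply : ∀ (E : IntermediateField K (AlgebraicClosure K)) [Normal K E]
      (σ : absoluteGaloisGroup K) (y : E),
      ((absRestrictNormalHom E σ y : E) : AlgebraicClosure K) = σ • (y : AlgebraicClosure K) :=
    fun E _ σ y => AlgEquiv.restrictNormalHom_apply E _ y
  -- §1 the subgroup `U'` (exponent `q = p^k`)
  set S : Subgroup U := W.subgroupOf U ⊔ ⁅(⊤ : Subgroup U), ⊤⁆ ⊔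
    Subgroup.closure (Set.range fun u : U => u ^ (p ^ k)) with hS
  set U' : Subgroup (absoluteGaloisGroup K) := S.map U.subtype with hU'def
  haveI hU'n : U'.Normal := map_subtype_sup_normal (p ^ k) U W
  have hU'le : U' ≤ U := by
    rintro _ ⟨x, -, rfl⟩
    exact x.2
  have hWU' : W ≤ U' := by
    intro w hw
    exact ⟨⟨w, hWU hw⟩, Subgroup.mem_sup_left (Subgroup.mem_sup_left (Subgroup.mem_subgroupOf.2 hw)), rfl⟩
  have hU'open : IsOpen (U' : Set (absoluteGaloisGroup K)) := Subgroup.isOpen_mono hWU' hW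
  -- every `g ∈ T` kills `U'`
  have hkill : ∀ g ∈ T, ∀ u : U, (u : absoluteGaloisGroup K) ∈ U' → g u = 0 := by
    intro g hg u hu
    obtain ⟨x, hx, hxu⟩ := hu
    have hxu' : x = u := Subtype.ext hxu
    subst hxu'
    obtain ⟨Z, hZ, hZc, hZp⟩ := exists_ker_subgroup (p ^ k) hpM g (hadd g hg)
    have hSZ : S ≤ Z :=
      sup_le (sup_le (fun y hy => (hZ y).2 (hW0 g hg y (Subgroup.mem_subgroupOf.1 hy))) hZc) hZp
    exact (hZ x).1 (hSZ hx)
  -- §2 the fields `F = K̄^U ≤ E' = K̄^{U'}`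
  set F : IntermediateField K (AlgebraicClosure K) := fixedField U with hFdef
  set E' : IntermediateField K (AlgebraicClosure K) := fixedField U' with hE'def
  have hFU : F.fixingSubgroup = U := fixingSubgroup_fixedField_of_isOpen U hU
  have hE'U' : E'.fixingSubgroup = U' := fixingSubgroup_fixedField_of_isOpen U' hU'open
  -- membership dictionaries (the two Galois-group types are definitionally equal)
  have hUiff : ∀ σ : absoluteGaloisGroup K, σ ∈ U ↔ ∀ x ∈ F, σ • x = x := fun σ => by
    refine (SetLike.ext_iff.mp hFU σ).symm.trans ?_
    exact IntermediateField.mem_fixingSubgroup_iff F (absoluteGaloisGroup.toAlgEquiv K σ)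
  have hFE' : F ≤ E' := by
    rw [hE'def, IntermediateField.le_iff_le]
    intro σ hσ
    exact (SetLike.ext_iff.mp hFU σ).2 (hU'le hσ)
  haveI : FiniteDimensional K E' := finiteDimensional_fixedField_of_isOpen U' hU'open
  haveI : FiniteDimensional K F := finiteDimensional_fixedField_of_isOpen U hU
  haveI hE'gal : IsGalois K E' := by
    rw [← InfiniteGalois.normal_iff_isGalois, hE'U']; exact hU'n
  haveI : NumberField E' := NumberField.of_module_finite K E'
  -- `F` as an intermediate field of `E'/K`
  set F' : IntermediateField K E' := IntermediateField.restrict hFE' with hF'def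
  haveI : FiniteDimensional K F' := IntermediateField.finiteDimensional_left F'
  haveI : NumberField F' := NumberField.of_module_finite K F'
  haveI : IsGalois F' E' := IsGalois.tower_top_of_isGalois K F' E'
  haveI : FiniteDimensional F' E' := Module.Finite.of_restrictScalars_finite K F' E'
  -- an element of `Γ_K` whose restriction to `E'` is `F'`-linear lies in `U`
  have hmemU_of : ∀ (σ : absoluteGaloisGroup K) (τ : E' ≃ₐ[F'] E'),
      absRestrictNormalHom E' σ = τ.restrictScalars K → σ ∈ U := by
    intro σ τ hσ
    rw [hUiff]
    intro x hx
    have hx' : (⟨x, hFE' hx⟩ : E') ∈ F' := (IntermediateField.mem_restrict hFE' _).2 hx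
    have h1 := hres_apply E' σ ⟨x, hFE' hx⟩
    rw [hσ, AlgEquiv.restrictScalars_apply] at h1
    rw [← h1]
    exact congrArg (fun z : E' => (z : AlgebraicClosure K)) (τ.commutes ⟨_, hx'⟩)
  -- the restriction `π : U → Gal(E'/F')`
  have hres_mem : ∀ u : U, absRestrictNormalHom E' (u : absoluteGaloisGroup K) ∈ F'.fixingSubgroup := by
    intro u
    rw [IntermediateField.mem_fixingSubgroup_iff]
    intro x hx
    apply Subtype.ext
    rw [hres_apply]
    exact (hUiff u).1 u.2 _ ((IntermediateField.mem_restrict hFE' x).1 hx)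
  let π : U →* (E' ≃ₐ[F'] E') :=
    (IntermediateField.fixingSubgroupEquiv F').toMonoidHom.comp
      (((absRestrictNormalHom E').comp U.subtype).codRestrict F'.fixingSubgroup hres_mem)
  have hπ_restrictScalars : ∀ u : U, (π u).restrictScalars K =
      absRestrictNormalHom E' (u : absoluteGaloisGroup K) := fun u => rfl
  -- `π` is surjective
  have hπ_surj : Function.Surjective π := by
    intro τ
    obtain ⟨σ, hσ⟩ := absRestrictNormalHom_surjective E' (τ.restrictScalars K)
    refine ⟨⟨σ, hmemU_of σ τ hσ⟩, ?_⟩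
    apply AlgEquiv.restrictScalars_injective K
    rw [hπ_restrictScalars]
    exact hσ
  -- `π u = 1` iff `u ∈ U'`
  have hker_π : ∀ u : U, π u = 1 → (u : absoluteGaloisGroup K) ∈ U' := by
    intro u hu
    have h1 : absRestrictNormalHom E' (u : absoluteGaloisGroup K) = 1 := by
      rw [← hπ_restrictScalars, hu]; exact AlgEquiv.ext fun _ => rfl
    rw [absRestrictNormalHom_eq_one_iff] at h1
    exact (SetLike.ext_iff.mp hE'U' _).1 h1
  have hπ_eq_one : ∀ u : U, (u : absoluteGaloisGroup K) ∈ U' → π u = 1 := by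
    intro u hu
    apply AlgEquiv.restrictScalars_injective K
    rw [hπ_restrictScalars]
    have h1 : absRestrictNormalHom E' (u : absoluteGaloisGroup K) = 1 :=
      (absRestrictNormalHom_eq_one_iff E' _).2 ((SetLike.ext_iff.mp hE'U' _).2 hu)
    rw [h1]
    exact AlgEquiv.ext fun _ => rfl
  have hfactor : ∀ g ∈ T, ∀ u₁ u₂ : U, π u₁ = π u₂ → g u₁ = g u₂ := by
    intro g hg u₁ u₂ h
    have h1 : π (u₂⁻¹ * u₁) = 1 := by rw [map_mul, map_inv, h, inv_mul_cancel]
    have h2 := hkill g hg _ (hker_π _ h1)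
    have h3 : g u₁ = g (u₂ * (u₂⁻¹ * u₁)) := by rw [mul_inv_cancel_left]
    rw [h3, hadd g hg, h2, add_zero]
  -- the descended maps `ḡ`
  let desc : (U → M) → ((E' ≃ₐ[F'] E') → M) := fun g τ => g (Function.surjInv hπ_surj τ)
  have hdesc : ∀ g ∈ T, ∀ u : U, desc g (π u) = g u := fun g hg u =>
    hfactor g hg _ _ (Function.surjInv_eq hπ_surj (π u))
  have hdesc_add : ∀ g ∈ T, ∀ a b, desc g (a * b) = desc g a + desc g b := by
    intro g hg a b
    obtain ⟨x, rfl⟩ := hπ_surj a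
    obtain ⟨y, rfl⟩ := hπ_surj b
    rw [← map_mul, hdesc g hg, hdesc g hg, hdesc g hg, hadd g hg]
  have hdesc_inj : Set.InjOn desc T := by
    intro g₁ hg₁ g₂ hg₂ h
    funext u
    rw [← hdesc g₁ hg₁ u, ← hdesc g₂ hg₂ u, h]
  -- `G = Gal(E'/F')` has exponent `q = p^k`: a `p`-group; `E'/F'` is unramified at the infinite places
  have hexp : ∀ τ : E' ≃ₐ[F'] E', τ ^ (p ^ k) = 1 := by
    intro τ
    obtain ⟨u, rfl⟩ := hπ_surj τ
    rw [← map_pow]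
    exact hπ_eq_one _ ⟨u ^ (p ^ k), Subgroup.mem_sup_right (Subgroup.subset_closure ⟨u, rfl⟩), rfl⟩
  have hG : IsPGroup p (E' ≃ₐ[F'] E') := fun τ => ⟨k, hexp τ⟩
  haveI : IsUnramifiedAtInfinitePlaces F' E' := by
    rcases hp with hp2 | hK
    · apply IsUnramifiedAtInfinitePlaces_of_odd_card_aut
      obtain ⟨c, hc⟩ := hG.exists_card_eq
      rw [hc]
      exact (hpr.odd_of_ne_two hp2).pow
    · haveI : NumberField.IsTotallyComplex F' := NumberField.isTotallyComplex_of_algebra K F'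
      exact ⟨fun w => (NumberField.InfinitePlace.isUnramified_iff).2
        (Or.inr (NumberField.IsTotallyComplex.isComplex _))⟩
  have hinert : ∀ g ∈ T, ∀ (Q : MaximalSpectrum (𝓞 E')),
      ∀ τ ∈ Q.asIdeal.inertia (E' ≃ₐ[F'] E'), desc g τ = 0 := by
    intro g hg Q τ hτ
    haveI := Q.isMaximal
    obtain ⟨𝔓, h𝔓max, h𝔓Q⟩ := exists_isMaximal_comap_ringOfIntegersToIntegralClosure_eq E' Q.asIdeal
    haveI := h𝔓max
    have hτK : τ.restrictScalars K ∈ Q.asIdeal.inertia (E' ≃ₐ[K] E') := by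
      rw [AddSubgroup.mem_inertia] at hτ ⊢
      intro x
      rw [RingOfIntegers.restrictScalars_smul]
      exact hτ x
    rw [← h𝔓Q, inertia_comap_ringOfIntegers_eq_map_absRestrictNormalHom E' 𝔓] at hτK
    obtain ⟨σ, hσI, hσ⟩ := hτK
    have hσU : σ ∈ U := hmemU_of σ τ hσ
    have hπσ : π ⟨σ, hσU⟩ = τ := by
      apply AlgEquiv.restrictScalars_injective K
      rw [hπ_restrictScalars]
      exact hσ
    rw [← hπσ, hdesc g hg]
    exact hI0 g hg 𝔓 h𝔓max ⟨σ, hσU⟩ hσI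
  -- §4 the subgroup killed by every `ḡ` and the class-field-theoretic index bound
  set Ngrp : Subgroup (E' ≃ₐ[F'] E') :=
    ⁅(⊤ : Subgroup (E' ≃ₐ[F'] E')), ⊤⁆ ⊔ ⨆ (Q : MaximalSpectrum (𝓞 E')), Q.asIdeal.inertia (E' ≃ₐ[F'] E')
    with hNgrp
  set N₂ : Subgroup (E' ≃ₐ[F'] E') :=
    Ngrp ⊔ Subgroup.closure (Set.range fun σ : E' ≃ₐ[F'] E' => σ ^ (p ^ k)) with hN₂
  have hcomm : ⁅(⊤ : Subgroup (E' ≃ₐ[F'] E')), ⊤⁆ ≤ Ngrp := le_sup_left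
  have hIN : ∀ (Q : Ideal (𝓞 E')) [Q.IsMaximal], Q.inertia (E' ≃ₐ[F'] E') ≤ Ngrp := by
    intro Q hQ
    exact le_trans (le_iSup (fun Q : MaximalSpectrum (𝓞 E') => Q.asIdeal.inertia (E' ≃ₐ[F'] E')) ⟨Q, hQ⟩)
      le_sup_right
  have hdvd := index_sup_pow_dvd_index_range_pow F' E' Ngrp hcomm hIN (p ^ k)
  haveI hN₂n : N₂.Normal := normal_of_commutator_le (hcomm.trans le_sup_left)
  -- every `ḡ` kills `N₂`
  have hkillN : ∀ g ∈ T, ∀ τ ∈ N₂, desc g τ = 0 := by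
    intro g hg τ hτ
    obtain ⟨Z, hZ, hZc, hZp⟩ := exists_ker_subgroup (p ^ k) hpM (desc g) (hdesc_add g hg)
    have hNZ : N₂ ≤ Z := by
      refine sup_le (sup_le hZc (iSup_le fun Q => fun x hx => (hZ x).2 (hinert g hg Q x hx))) hZp
    exact (hZ τ).1 (hNZ hτ)
  -- §5 the `ḡ` are HOMOMORPHISMS on the `p`-group `G/N₂`, determined on `r` generators, `p^r = [G : N₂]`
  let lift : (U → M) → ((E' ≃ₐ[F'] E') ⧸ N₂ → M) := fun g q => desc g q.out
  have hlift : ∀ g ∈ T, ∀ τ, lift g (QuotientGroup.mk τ) = desc g τ := by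
    intro g hg τ
    change desc g (QuotientGroup.mk τ : (E' ≃ₐ[F'] E') ⧸ N₂).out = desc g τ
    have h1 : ((QuotientGroup.mk τ : (E' ≃ₐ[F'] E') ⧸ N₂).out)⁻¹ * τ ∈ N₂ := by
      rw [← QuotientGroup.eq, QuotientGroup.out_eq']
    have h2 : τ = (QuotientGroup.mk τ : (E' ≃ₐ[F'] E') ⧸ N₂).out *
        (((QuotientGroup.mk τ : (E' ≃ₐ[F'] E') ⧸ N₂).out)⁻¹ * τ) := by rw [mul_inv_cancel_left]
    conv_rhs => rw [h2]
    rw [hdesc_add g hg, hkillN g hg _ h1, add_zero]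
  have hlift_add : ∀ g ∈ T, ∀ a b : (E' ≃ₐ[F'] E') ⧸ N₂, lift g (a * b) = lift g a + lift g b := by
    intro g hg a b
    obtain ⟨x, rfl⟩ := QuotientGroup.mk_surjective a
    obtain ⟨y, rfl⟩ := QuotientGroup.mk_surjective b
    rw [← QuotientGroup.mk_mul, hlift g hg, hlift g hg, hlift g hg, hdesc_add g hg]
  have hlift_inj : Set.InjOn lift T := by
    intro g₁ hg₁ g₂ hg₂ h
    apply hdesc_inj hg₁ hg₂
    funext τ
    rw [← hlift g₁ hg₁, ← hlift g₂ hg₂, h]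
  -- generators of the `p`-group `G/N₂`
  have hQp : IsPGroup p ((E' ≃ₐ[F'] E') ⧸ N₂) := hG.to_quotient N₂
  obtain ⟨s, hs, hscard⟩ := exists_finset_card_le_closure_eq_top_of_isPGroup p hQp
  obtain ⟨r, hr⟩ := hQp.exists_card_eq
  -- counting: `T ↪ (s → M)`
  have h1 : T.card ≤ Nat.card M ^ s.card := by
    let ev : (U → M) → (↥(s : Set ((E' ≃ₐ[F'] E') ⧸ N₂)) → M) := fun g x => lift g x.1
    have hinj : Function.Injective (fun g : (T : Set (U → M)) => ev g.1) := by
      rintro ⟨a, ha⟩ ⟨b, hb⟩ h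
      apply Subtype.ext
      apply hlift_inj ha hb
      refine eq_of_eqOn_closure_eq_top hs (hlift_add a ha) (hlift_add b hb) fun x hx => ?_
      exact congrFun h ⟨x, hx⟩
    have hle := Nat.card_le_card_of_injective _ hinj
    rw [Nat.card_coe_set_eq, Set.ncard_coe_finset, Nat.card_fun, Nat.card_coe_set_eq,
      Set.ncard_coe_finset] at hle
    exact hle
  -- `p ^ #s ≤ #(G/N₂) = p ^ r = [G : N₂] ∣ [Cl(F') : Cl(F')^q] = [Cl(F) : Cl(F)^q]`
  have hMpos : 0 < Nat.card M := Nat.card_pos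
  have hsr : s.card ≤ r := (Nat.pow_le_pow_iff_right hpr.one_lt).1 (by rw [← hr]; exact hscard)
  have hidx : Nat.card ((E' ≃ₐ[F'] E') ⧸ N₂) = N₂.index := rfl
  have hidx_ne : (powMonoidHom (p ^ k) : ClassGroup (𝓞 F') →* ClassGroup (𝓞 F')).range.index ≠ 0 :=
    Subgroup.index_ne_zero_of_finite
  have h2 : r ≤ padicValNat p ((powMonoidHom (p ^ k) : ClassGroup (𝓞 F') →* ClassGroup (𝓞 F')).range.index) := by
    rw [← padicValNat_dvd_iff_le hidx_ne, ← hr, hidx]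
    exact hdvd
  have eCl : ClassGroup (𝓞 F) ≃* ClassGroup (𝓞 F') :=
    ClassGroup.mulEquiv (RingOfIntegers.mapRingEquiv (IntermediateField.restrict_algEquiv hFE').toRingEquiv)
  have h3 : (powMonoidHom (p ^ k) : ClassGroup (𝓞 F') →* ClassGroup (𝓞 F')).range.index =
      (powMonoidHom (p ^ k) : ClassGroup (𝓞 F) →* ClassGroup (𝓞 F)).range.index :=
    index_range_pow_eq_of_mulEquiv eCl (p ^ k)
  calc T.card ≤ Nat.card M ^ s.card := h1
    _ ≤ Nat.card M ^ r := Nat.pow_le_pow_right hMpos hsr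
    _ ≤ Nat.card M ^ padicValNat p
          ((powMonoidHom (p ^ k) : ClassGroup (𝓞 F') →* ClassGroup (𝓞 F')).range.index) :=
        Nat.pow_le_pow_right hMpos h2
    _ = _ := by rw [h3]

/-- **Corollary (class-number form).** Under the hypotheses of `card_le_pow_padicValNat_index_of_unramified`,
`#T ≤ #M ^ ord_p #Cl(F)`: the index `[Cl(F) : Cl(F)^q]` divides the class number.
[cite: Washington1997, §13.3 Prop. 13.23] [cite: Lang1990, Ch. 5 §4 (card C_n = p^{e_n})] -/
theorem card_le_pow_padicValNat_card_classGroup_of_unramified (hp : p ≠ 2 ∨ NumberField.IsTotallyComplex K)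
    (k : ℕ) (hU : IsOpen (U : Set (absoluteGaloisGroup K)))
    (hW : IsOpen (W : Set (absoluteGaloisGroup K))) (hWU : W ≤ U)
    (M : Type) [AddCommGroup M] [Finite M] (hpM : ∀ m : M, p ^ k • m = 0)
    (T : Finset (U → M))
    (hadd : ∀ g ∈ T, ∀ u v : U, g (u * v) = g u + g v)
    (hW0 : ∀ g ∈ T, ∀ u : U, (u : absoluteGaloisGroup K) ∈ W → g u = 0)
    (hI0 : ∀ g ∈ T, ∀ (𝔓 : Ideal (absIntegers (𝓞 K) K)), 𝔓.IsMaximal →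
      ∀ u : U, (u : absoluteGaloisGroup K) ∈ 𝔓.inertia (absoluteGaloisGroup K) → g u = 0) :
    T.card ≤ Nat.card M ^ padicValNat p
      (Nat.card (ClassGroup (𝓞 (fixedField U : IntermediateField K (AlgebraicClosure K))))) := by
  haveI : FiniteDimensional K (fixedField U : IntermediateField K (AlgebraicClosure K)) :=
    finiteDimensional_fixedField_of_isOpen U hU
  haveI : NumberField (fixedField U : IntermediateField K (AlgebraicClosure K)) :=
    NumberField.of_module_finite K _
  refine (card_le_pow_padicValNat_index_of_unramified p U W hp k hU hW hWU M hpM T hadd hW0 hI0).trans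
    (Nat.pow_le_pow_right Nat.card_pos ?_)
  have hdvd : (powMonoidHom (p ^ k) :
      ClassGroup (𝓞 (fixedField U : IntermediateField K (AlgebraicClosure K))) →*
        ClassGroup (𝓞 (fixedField U : IntermediateField K (AlgebraicClosure K)))).range.index ∣
      Nat.card (ClassGroup (𝓞 (fixedField U : IntermediateField K (AlgebraicClosure K)))) :=
    Subgroup.index_dvd_card _
  have hne : Nat.card (ClassGroup (𝓞 (fixedField U : IntermediateField K (AlgebraicClosure K)))) ≠ 0 :=
    Nat.card_pos.ne'
  exact (padicValNat_dvd_iff_le hne).1 (pow_padicValNat_dvd.trans hdvd)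

end Main

end Literature.NumberTheory.NumberFields.UnramifiedHomsClassGroupPRankBoundSharp

end
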